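import Literature.AlgebraicGeometry.Resolution.SteinFinitePartEtaleNeighbourhood
import Literature.AlgebraicGeometry.Resolution.SteinFinitePartEtaleCriterion
import Literature.AlgebraicGeometry.Resolution.SteinFinitePartEtaleAmbient
import Literature.AlgebraicGeometry.Resolution.SectionsOfBaseChange
import Literature.AlgebraicGeometry.Resolution.NormalSectionsIntegrallyClosed
import Literature.AlgebraicGeometry.Resolution.EtaleFromNormalizationLocal
import Literature.AlgebraicGeometry.Morphisms.GeometricallyConnectedOfSection
import HarnessLib

/-!
# De Jong 1996, 4.12: the finite part of the Stein factorisation is étale (the local argument)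

Topic: `Literature/AlgebraicGeometry/Resolution`. De Jong 1996, 4.12 (p. 68): "Note that `X'` is
normal also. […] Let `X' → Y' → ℙ^{d-1}` be the Stein factorization of `f`. Note that
`Y' → ℙ^{d-1}` is (finite) étale, in view of property (ii) b) of the lemma (cf. [18])." This
file PROVES the general statement behind the sentence:

**Theorem** (`etale_fromNormalization_of_dense_smoothLocus`). Let `k` be algebraically closed,
`Y` locally of finite type over `k`, `X` integral with integrally closed local rings (normal),
`f : X → Y` proper, surjective and locally of finite presentation, such that for every closed
point `y` the smooth locus of `f` is dense in the fibre `X_y`. Then the finite part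
`π : Y' = f.normalization → Y` of the Stein factorisation of `f` (Mathlib's relative
normalization, Stacks 035H) is étale.

Proof (no henselisation, no coherence theorem): by `etale_fromNormalization_of_forall_isClosed`
(03GV + fppf descent + Jacobson) it suffices to find, for each closed `y`, an étale `g : U → Y`
through `y` with `(X ×_Y U → U).fromNormalization` étale (`exists_etale_nhd_etale_fromNormalization`).
Take the good neighbourhood of `exists_good_etale_nhd` (affine connected `U`, sections `σᵢ`
through a smooth closed point of every part of `X_y`, every irreducible component of `X ×_Y U`
meeting the fibre over `u`). Then `B = Γ(X ×_Y U, 𝒪) ≅ Γ(X, f⁻¹V) ⊗_{Γ(V)} Γ(U)`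
(`exists_ringEquiv_tensor_sections_pullback`) is integral over `R = Γ(U)`, sits integrally closed
in a finite product of fields (`exists_ambient_prod_fields_of_etale`, Stacks 03GE, `X` normal:
`mem_range_of_isIntegral_sections`), and every non-zero idempotent `e ∈ B` is met by a section
(`exists_section_appTop_ne_zero`: the clopen `D(e) ⊆ X ×_Y U` contains an irreducible component,
hence a closed point over `u`, whose part of the fibre `X_y` contains some `xᵢ`, so `σᵢ(u) ∈ D(e)`
and `σᵢ^* e = 1` as `U` is connected); so `B ≃ Rⁿ` is étale over `R`
(`etale_of_idempotents_met_by_sections`) and `Y'_U → U` is étale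
(`etale_fromNormalization_of_etale_appTop`).

No definitions, no named facts; the named fact `DeJong1996SteinFactorizationEtale` is discharged
from this theorem in `AlterationsFibresConnectedHolds.lean`.

## Sources

* A. J. de Jong, *Smoothness, semi-stability and alterations*, Publ. Math. IHÉS 83 (1996), 4.12,
  p. 68. [DeJong1996]
* The Stacks Project, Tags 035H, 03GE, 03GV, 02VN. [StacksProject]
-/

noncomputable section

open CategoryTheory CategoryTheory.Limits AlgebraicGeometry TopologicalSpace Topology
open TensorProduct

namespace Literature.AlgebraicGeometry.Resolution

universe u

open Literature.AlgebraicGeometry.Morphisms (eq_zero_or_one_of_isIdempotentElem)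

/-! ## Idempotent global functions: the clopen `D(e)` -/

/-- In a local ring an idempotent is `0` or `1`. [folklore] -/
theorem isIdempotentElem_eq_zero_or_one_of_isLocalRing {R : Type*} [CommRing R] [IsLocalRing R]
    {a : R} (ha : IsIdempotentElem a) : a = 0 ∨ a = 1 := by
  have hmul : a * (1 - a) = 0 := by rw [mul_sub, mul_one, ha.eq, sub_self]
  rcases IsLocalRing.isUnit_or_isUnit_one_sub_self a with hu | hu
  · right
    have : (1 - a) = 0 := by
      have := congrArg (fun t => hu.unit⁻¹.1 * t) hmul
      simpa [← mul_assoc] using this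
    exact (sub_eq_zero.mp this).symm
  · left
    have := congrArg (fun t => t * hu.unit⁻¹.1) hmul
    simpa [mul_assoc] using this

/-- For an idempotent global function `e`, the non-vanishing locus `D(e)` is open AND closed:
its complement is `D(1 - e)` (germs of `e` are `0` or `1`). [folklore] -/
theorem isClopen_basicOpen_of_isIdempotentElem (X : Scheme.{u}) (e : Γ(X, ⊤))
    (he : IsIdempotentElem e) : IsClopen (X.basicOpen e : Set X) := by
  have hgerm : ∀ x : X, X.presheaf.germ ⊤ x trivial e = 0 ∨ X.presheaf.germ ⊤ x trivial e = 1 :=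
    fun x => isIdempotentElem_eq_zero_or_one_of_isLocalRing
      (he.map (X.presheaf.germ ⊤ x trivial).hom)
  have hUV : ((X.basicOpen e : Set X))ᶜ = (X.basicOpen (1 - e) : Set X) := by
    ext x
    simp only [Set.mem_compl_iff, SetLike.mem_coe, Scheme.mem_basicOpen_top, map_sub, map_one]
    rcases hgerm x with h0 | h1
    · rw [h0, sub_zero]
      exact ⟨fun _ => isUnit_one, fun _ => not_isUnit_zero⟩
    · rw [h1, sub_self]
      exact ⟨fun h => (h isUnit_one).elim, fun h => (not_isUnit_zero h).elim⟩
  refine ⟨?_, (X.basicOpen e).isOpen⟩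
  rw [← isOpen_compl_iff, hUV]
  exact (X.basicOpen (1 - e)).isOpen

/-- An idempotent global function with empty non-vanishing locus is `0` (all its germs are
idempotent non-units of local rings, hence `0`). [folklore] -/
theorem eq_zero_of_basicOpen_eq_bot_of_isIdempotentElem (X : Scheme.{u}) (e : Γ(X, ⊤))
    (he : IsIdempotentElem e) (h : X.basicOpen e = ⊥) : e = 0 := by
  apply TopCat.Presheaf.section_ext X.sheaf ⊤ e 0
  intro x hx
  rw [map_zero]
  rcases isIdempotentElem_eq_zero_or_one_of_isLocalRing
      (he.map (X.presheaf.germ ⊤ x trivial).hom) with h0 | h1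
  · exact h0
  · exfalso
    have hxU : x ∈ X.basicOpen e := by
      rw [Scheme.mem_basicOpen_top]
      change IsUnit ((X.presheaf.germ ⊤ x trivial).hom e)
      rw [h1]
      exact isUnit_one
    rw [h] at hxU
    exact hxU

/-- If a point `q : Spec K → Z` lands in `D(e)` then `q^* e ≠ 0`. [folklore] -/
theorem appTop_ne_zero_of_apply_mem_basicOpen {K : Type u} [Field K] {Z : Scheme.{u}}
    (q : Spec (.of K) ⟶ Z) (e : Γ(Z, ⊤)) (hq : q (IsLocalRing.closedPoint K) ∈ Z.basicOpen e) :
    q.appTop e ≠ 0 := by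
  intro h0
  have hmem : IsLocalRing.closedPoint K ∈ q ⁻¹ᵁ Z.basicOpen e := hq
  rw [Scheme.preimage_basicOpen_top, h0, Scheme.basicOpen_zero] at hmem
  exact hmem

/-! ## `k`-points over `k` at closed points -/

section KPoints

variable {k : Type u} [Field k] [IsAlgClosed k]

omit [IsAlgClosed k] in
/-- The point of a `k`-point over `k` is closed. [folklore] -/
theorem isClosed_singleton_apply_of_comp_eq_id {Z : Scheme.{u}} (h : Z ⟶ Spec (.of k))
    (q : Spec (.of k) ⟶ Z) (hq : q ≫ h = 𝟙 _) :
    IsClosed ({q (IsLocalRing.closedPoint k)} : Set Z) := by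
  haveI := isClosedImmersion_of_comp_eq_id h q hq
  have hr : Set.range q = {q (IsLocalRing.closedPoint k)} := by
    ext z
    constructor
    · rintro ⟨a, rfl⟩
      rw [Subsingleton.elim a (IsLocalRing.closedPoint k)]
      rfl
    · rintro rfl
      exact ⟨_, rfl⟩
  rw [← hr]
  exact q.isClosedEmbedding.isClosed_range

/-- A `k`-point over `k` IS the `k`-point at its (closed) point (`ext_of_apply_closedPoint_eq`).
[folklore] -/
theorem eq_pointOfClosedPoint_of_comp_eq_id {Z : Scheme.{u}} (h : Z ⟶ Spec (.of k))
    [LocallyOfFiniteType h] (q : Spec (.of k) ⟶ Z) (hq : q ≫ h = 𝟙 _) {z : Z}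
    (hz : IsClosed ({z} : Set Z)) (hqz : q (IsLocalRing.closedPoint k) = z) :
    q = pointOfClosedPoint h z hz :=
  ext_of_apply_closedPoint_eq h hq (pointOfClosedPoint_comp h z hz)
    (by rw [hqz, pointOfClosedPoint_apply])

end KPoints

/-! ## Non-zero idempotents of `Γ(X ×_Y U)` are met by the sections -/

/-- **The key step of de Jong 1996, 4.12.** In the situation of `exists_good_etale_nhd`
(sections `σᵢ : U → X` through closed points `xᵢ` over `y` such that every non-empty clopen part
of the fibre `X_y` contains some `xᵢ`; every irreducible component of `X ×_Y U` meeting the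
fibre over the point `u` of the `k`-point `pu`), every non-zero idempotent `e ∈ Γ(X ×_Y U, 𝒪)`
is non-zero at `σ̃ᵢ(u)` for some `i`, `σ̃ᵢ = (σᵢ, 1) : U → X ×_Y U`: the clopen `D(e)` contains
the irreducible component of any of its points, hence a CLOSED point `p` over `u`; comparing
`k`-points, `p = λ(φ)` for the canonical `λ : X_y → X ×_Y U` and the point `φ` of `X_y` under
`p`; the clopen `λ⁻¹ D(e) ∋ φ` contains some chosen point `zᵢ ↦ xᵢ`, and `λ(zᵢ) = σ̃ᵢ(u)`.
[cite: DeJong1996, 4.12, p. 68] -/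
theorem exists_section_appTop_ne_zero {k : Type u} [Field k] [IsAlgClosed k]
    {X Y U : Scheme.{u}} (gY : Y ⟶ Spec (.of k)) [LocallyOfFiniteType gY] (f : X ⟶ Y)
    [LocallyOfFiniteType f] [QuasiCompact f] (y : Y) (hy : IsClosed ({y} : Set Y)) (g : U ⟶ Y)
    [LocallyOfFiniteType g] [CompactSpace U] (pu : Spec (.of k) ⟶ U)
    (hpu : pu ≫ g = pointOfClosedPoint gY y hy) {ι : Type u} (x : ι → X)
    (hxc : ∀ i, IsClosed ({x i} : Set X))
    (hclopen : ∀ W : Set ↥(f.fiber y), IsClopen W → W.Nonempty →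
      ∃ i, ∃ z : ↥(f.fiber y), z ∈ W ∧ f.fiberι y z = x i)
    (σ : ι → (U ⟶ X)) (hσf : ∀ i, σ i ≫ f = g)
    (hσp : ∀ i, pu ≫ σ i = pointOfClosedPoint (f ≫ gY) (x i) (hxc i))
    (hcomp : ∀ Z ∈ irreducibleComponents ↥(pullback f g),
      pu (IsLocalRing.closedPoint k) ∈ (pullback.snd f g) '' Z)
    (e : Γ(pullback f g, ⊤)) (he : IsIdempotentElem e) (hne : e ≠ 0) :
    ∃ i, (pu ≫ pullback.lift (σ i) (𝟙 U) (by rw [hσf, Category.id_comp])).appTop e ≠ 0 := by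
  have hsg : pullback.snd f g ≫ g ≫ gY = pullback.fst f g ≫ f ≫ gY := by
    rw [← Category.assoc, ← pullback.condition, Category.assoc]
  -- the clopen `D(e)` is non-empty and contains an irreducible component
  have hclW : IsClopen ((pullback f g).basicOpen e : Set ↥(pullback f g)) :=
    isClopen_basicOpen_of_isIdempotentElem _ e he
  have hWne : ((pullback f g).basicOpen e : Set ↥(pullback f g)).Nonempty := by
    rw [Set.nonempty_iff_ne_empty]
    intro hW
    apply hne
    apply eq_zero_of_basicOpen_eq_bot_of_isIdempotentElem _ e he
    exact TopologicalSpace.Opens.ext (by rw [hW]; simp)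
  obtain ⟨w, hw⟩ := hWne
  have hZW : irreducibleComponent w ⊆ ((pullback f g).basicOpen e : Set ↥(pullback f g)) :=
    isIrreducible_irreducibleComponent.2.isPreconnected.subset_isClopen hclW
      ⟨w, mem_irreducibleComponent, hw⟩
  obtain ⟨p₀, hp₀Z, hp₀u⟩ := hcomp _ (irreducibleComponent_mem_irreducibleComponents w)
  -- a CLOSED point `p` of `D(e)` over `u`
  have hpu1 : pu ≫ g ≫ gY = 𝟙 _ := by rw [← Category.assoc, hpu, pointOfClosedPoint_comp]
  have hu_closed : IsClosed ({pu (IsLocalRing.closedPoint k)} : Set U) :=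
    isClosed_singleton_apply_of_comp_eq_id (g ≫ gY) pu hpu1
  have hS : IsClosed (((pullback f g).basicOpen e : Set ↥(pullback f g)) ∩
      (pullback.snd f g) ⁻¹' {pu (IsLocalRing.closedPoint k)}) :=
    hclW.1.inter (hu_closed.preimage (pullback.snd f g).continuous)
  obtain ⟨p, ⟨hpW, hpu'⟩, hpc⟩ := hS.exists_closed_singleton ⟨p₀, hZW hp₀Z, hp₀u⟩
  have hpu'' : (pullback.snd f g) p = pu (IsLocalRing.closedPoint k) := hpu'
  -- `p` as a `k`-point
  have hpp_comp : pointOfClosedPoint (pullback.snd f g ≫ g ≫ gY) p hpc ≫ pullback.snd f g ≫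
      g ≫ gY = 𝟙 _ := pointOfClosedPoint_comp _ _ _
  have hpp_snd : pointOfClosedPoint (pullback.snd f g ≫ g ≫ gY) p hpc ≫ pullback.snd f g =
      pu := by
    refine ext_of_apply_closedPoint_eq (g ≫ gY) ?_ hpu1 ?_
    · rw [Category.assoc]
      exact hpp_comp
    · rw [Scheme.Hom.comp_apply, pointOfClosedPoint_apply]
      exact hpu''
  -- its image `x'` in `X`: a closed point over `y`
  have hfx' : f (pullback.fst f g p) = y := by
    rw [← Scheme.Hom.comp_apply, pullback.condition, Scheme.Hom.comp_apply, hpu'',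
      ← Scheme.Hom.comp_apply, hpu, pointOfClosedPoint_apply]
  have hppf : (pointOfClosedPoint (pullback.snd f g ≫ g ≫ gY) p hpc ≫ pullback.fst f g) ≫
      f ≫ gY = 𝟙 _ := by
    rw [Category.assoc, ← hsg]
    exact hpp_comp
  have hx'c : IsClosed ({pullback.fst f g p} : Set X) := by
    have := isClosed_singleton_apply_of_comp_eq_id (f ≫ gY) _ hppf
    rwa [Scheme.Hom.comp_apply, pointOfClosedPoint_apply] at this
  have hpp_fst : pointOfClosedPoint (pullback.snd f g ≫ g ≫ gY) p hpc ≫ pullback.fst f g =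
      pointOfClosedPoint (f ≫ gY) (pullback.fst f g p) hx'c :=
    eq_pointOfClosedPoint_of_comp_eq_id (f ≫ gY) _ hppf hx'c
      (by rw [Scheme.Hom.comp_apply, pointOfClosedPoint_apply])
  -- the comparison `λ : X_y → X ×_Y U`
  have hiso : Spec.map (residueFieldIsoBase gY y hy).inv ≫
      Spec.map (residueFieldIsoBase gY y hy).hom = 𝟙 _ := by
    rw [← Spec.map_comp, Iso.hom_inv_id, Spec.map_id]
  set hF : f.fiber y ⟶ Spec (.of k) :=
    f.fiberToSpecResidueField y ≫ Spec.map (residueFieldIsoBase gY y hy).inv with hFdef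
  have hF_eq : hF = f.fiberι y ≫ f ≫ gY := by
    rw [hFdef, SpecMap_residueFieldIsoBase_inv, Scheme.Hom.fiber_fac_assoc]
  haveI : LocallyOfFiniteType (f.fiberToSpecResidueField y) :=
    MorphismProperty.pullback_snd (P := @LocallyOfFiniteType) _ _ inferInstance
  haveI : LocallyOfFiniteType hF := by rw [hFdef]; infer_instance
  have hpy : pointOfClosedPoint gY y hy =
      Spec.map (residueFieldIsoBase gY y hy).hom ≫ Y.fromSpecResidueField y := rfl
  have hlam_w : f.fiberι y ≫ f = (hF ≫ pu) ≫ g := by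
    rw [Category.assoc, hpu, Scheme.Hom.fiber_fac, hFdef, hpy, Category.assoc,
      reassoc_of% hiso]
  let lam : f.fiber y ⟶ pullback f g := pullback.lift (f.fiberι y) (hF ≫ pu) hlam_w
  -- closed points of the fibre over closed points of `X`, as `k`-points
  have hfibc : ∀ (ζ : ↥(f.fiber y)), IsClosed ({f.fiberι y ζ} : Set X) →
      IsClosed ({ζ} : Set ↥(f.fiber y)) := by
    intro ζ hζ
    have : ({ζ} : Set ↥(f.fiber y)) = (f.fiberι y) ⁻¹' {f.fiberι y ζ} := by
      ext z
      simp only [Set.mem_singleton_iff, Set.mem_preimage]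
      exact ⟨fun h => by rw [h], fun h => (f.fiberι y).isEmbedding.injective h⟩
    rw [this]
    exact hζ.preimage (f.fiberι y).continuous
  have hfibpt : ∀ (ζ : ↥(f.fiber y)) (hζ : IsClosed ({f.fiberι y ζ} : Set X)),
      pointOfClosedPoint hF ζ (hfibc ζ hζ) ≫ f.fiberι y =
        pointOfClosedPoint (f ≫ gY) (f.fiberι y ζ) hζ := by
    intro ζ hζ
    refine eq_pointOfClosedPoint_of_comp_eq_id (f ≫ gY) _ ?_ hζ
      (by rw [Scheme.Hom.comp_apply, pointOfClosedPoint_apply])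
    rw [Category.assoc, ← hF_eq]
    exact pointOfClosedPoint_comp _ _ _
  -- `λ φ = p` for the point `φ` of the fibre under `x'`
  have hx'range : pullback.fst f g p ∈ Set.range (f.fiberι y) := by
    rw [Scheme.Hom.range_fiberι]; exact hfx'
  obtain ⟨φ, hφ⟩ := hx'range
  have hφc : IsClosed ({f.fiberι y φ} : Set X) := by rw [hφ]; exact hx'c
  have hpφ_lam : pointOfClosedPoint hF φ (hfibc φ hφc) ≫ lam =
      pointOfClosedPoint (pullback.snd f g ≫ g ≫ gY) p hpc := by
    apply pullback.hom_ext
    · rw [Category.assoc, pullback.lift_fst, hfibpt φ hφc, hpp_fst]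
      congr 1
    · rw [Category.assoc, pullback.lift_snd, ← Category.assoc, pointOfClosedPoint_comp,
        Category.id_comp, hpp_snd]
  have hlamφ : lam φ = p := by
    have h1 : φ = pointOfClosedPoint hF φ (hfibc φ hφc) (IsLocalRing.closedPoint k) :=
      (pointOfClosedPoint_apply _ _ _ _).symm
    rw [h1, ← Scheme.Hom.comp_apply, hpφ_lam, pointOfClosedPoint_apply]
  -- the clopen part of the fibre and a chosen point in it
  have hWF : IsClopen (lam ⁻¹' ((pullback f g).basicOpen e : Set ↥(pullback f g))) :=
    hclW.preimage lam.continuous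
  obtain ⟨i, z, hzW, hzx⟩ := hclopen _ hWF ⟨φ, show lam φ ∈ _ by rw [hlamφ]; exact hpW⟩
  have hzc : IsClosed ({f.fiberι y z} : Set X) := by rw [hzx]; exact hxc i
  refine ⟨i, ?_⟩
  have hpz_lam : pointOfClosedPoint hF z (hfibc z hzc) ≫ lam =
      pu ≫ pullback.lift (σ i) (𝟙 U) (by rw [hσf, Category.id_comp]) := by
    apply pullback.hom_ext
    · rw [Category.assoc, pullback.lift_fst, hfibpt z hzc, Category.assoc, pullback.lift_fst,
        hσp]
      congr 1
    · rw [Category.assoc, pullback.lift_snd, ← Category.assoc, pointOfClosedPoint_comp,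
        Category.id_comp, Category.assoc, pullback.lift_snd, Category.comp_id]
  apply appTop_ne_zero_of_apply_mem_basicOpen
  rw [← hpz_lam, Scheme.Hom.comp_apply, pointOfClosedPoint_apply]
  exact hzW

/-! ## The per-point statement and the theorem -/

/-- **De Jong 1996, 4.12, étale-locally at a closed point**: for `f : X → Y` proper surjective,
locally of finite presentation, `X` integral and normal, `Y` locally of finite type over the
algebraically closed `k`, and a closed point `y` with the smooth locus of `f` dense in `X_y`,
there is an étale `g : U → Y` through `y` such that the finite part of the Stein factorisation
of `X ×_Y U → U` is étale (indeed `Γ(X ×_Y U) ≃ Γ(U)ⁿ`). [cite: DeJong1996, 4.12, p. 68] -/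
theorem exists_etale_nhd_etale_fromNormalization {k : Type u} [Field k] [IsAlgClosed k]
    {X Y : Scheme.{u}} [IsIntegral X] (hN : ∀ x : X, IsIntegrallyClosed (X.presheaf.stalk x))
    (gY : Y ⟶ Spec (.of k)) [LocallyOfFiniteType gY] (f : X ⟶ Y) [IsProper f] [Surjective f]
    [LocallyOfFinitePresentation f] (y : Y) (hy : IsClosed ({y} : Set Y))
    (hsm : Dense ((f.fiberι y) ⁻¹' (f.smoothLocus : Set X))) :
    ∃ (U : Scheme.{u}) (g : U ⟶ Y) (_ : Etale g),
      y ∈ Set.range g ∧ Etale (pullback.snd f g).fromNormalization := by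
  haveI : IsLocallyNoetherian Y := LocallyOfFiniteType.isLocallyNoetherian gY
  -- an affine open around `y`, the chosen points, the good neighbourhood
  obtain ⟨V, hV, hyV, -⟩ := exists_isAffineOpen_mem_and_subset (x := y) (U := ⊤) trivial
  obtain ⟨ι, _, x, hxs, hxc, hxy, hclopen⟩ := exists_smooth_closed_points_on_fiber f y hy hsm
  have hxy' : ∀ i, pointOfClosedPoint (f ≫ gY) (x i) (hxc i) ≫ f =
      pointOfClosedPoint gY y hy := by
    intro i
    refine ext_of_apply_closedPoint_eq gY ?_ (pointOfClosedPoint_comp _ _ _) ?_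
    · rw [Category.assoc]
      exact pointOfClosedPoint_comp _ _ _
    · rw [Scheme.Hom.comp_apply, pointOfClosedPoint_apply, pointOfClosedPoint_apply, hxy i]
  obtain ⟨U, _, _, g, hg, pu, hUV, hpu, hσ, hcomp⟩ :=
    exists_good_etale_nhd gY f y hy ι x hxs hxc hxy' V hyV
  choose σ hσf hσp using hσ
  refine ⟨U, g, hg, ⟨pu (IsLocalRing.closedPoint k), by
    rw [← Scheme.Hom.comp_apply, hpu, pointOfClosedPoint_apply]⟩, ?_⟩
  -- `B = Γ(X ×_Y U)` over `R = Γ(U)`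
  algebraize [(pullback.snd f g).appTop.hom]
  haveI hint : Algebra.IsIntegral Γ(U, ⊤) Γ(pullback f g, ⊤) :=
    ⟨isIntegral_appTop_of_universallyClosed (pullback.snd f g)⟩
  -- every non-zero idempotent is met by a section
  have hsec : ∀ e : Γ(pullback f g, ⊤), IsIdempotentElem e → e ≠ 0 →
      ∃ s : Γ(pullback f g, ⊤) →ₐ[Γ(U, ⊤)] Γ(U, ⊤), s e = 1 := by
    intro e he hne
    obtain ⟨i, hi⟩ := exists_section_appTop_ne_zero gY f y hy g pu hpu x hxc hclopen σ hσf hσp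
      hcomp e he hne
    have hτ : pullback.lift (σ i) (𝟙 U) (by rw [hσf, Category.id_comp]) ≫ pullback.snd f g =
        𝟙 U := pullback.lift_snd _ _ _
    let s : Γ(pullback f g, ⊤) →ₐ[Γ(U, ⊤)] Γ(U, ⊤) :=
      { toRingHom := (pullback.lift (σ i) (𝟙 U) (by rw [hσf, Category.id_comp])).appTop.hom
        commutes' := fun r => by
          change (pullback.lift (σ i) (𝟙 U) _).appTop.hom ((pullback.snd f g).appTop.hom r) = r
          rw [← RingHom.comp_apply, ← CommRingCat.hom_comp, ← Scheme.Hom.comp_appTop, hτ,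
            Scheme.Hom.id_appTop]
          rfl }
    refine ⟨s, ?_⟩
    rcases eq_zero_or_one_of_isIdempotentElem U (s e) (he.map s) with h0 | h1
    · exfalso
      apply hi
      rw [Scheme.Hom.comp_appTop]
      change pu.appTop.hom (s e) = 0
      rw [h0, map_zero]
    · exact h1
  -- the ambient product of fields (Stacks 03GE), through `Γ(X ×_Y U) ≅ Γ(f⁻¹V) ⊗ Γ(U)`
  haveI : Nonempty (f ⁻¹ᵁ V) := by
    obtain ⟨x₀, hx₀⟩ := f.surjective y
    exact ⟨⟨x₀, show f x₀ ∈ V by rw [hx₀]; exact hyV⟩⟩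
  letI algPB : Algebra Γ(Y, V) Γ(X, f ⁻¹ᵁ V) := (f.app V).hom.toAlgebra
  letI algPR : Algebra Γ(Y, V) Γ(U, ⊤) := (g.appLE V ⊤ hUV).hom.toAlgebra
  letI algPK : Algebra Γ(Y, V) X.functionField :=
    ((algebraMap Γ(X, f ⁻¹ᵁ V) X.functionField).comp (f.app V).hom).toAlgebra
  haveI : IsScalarTower Γ(Y, V) Γ(X, f ⁻¹ᵁ V) X.functionField :=
    IsScalarTower.of_algebraMap_eq (fun _ => rfl)
  haveI : Algebra.Etale Γ(Y, V) Γ(U, ⊤) :=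
    HasRingHomProperty.appLE @Etale g hg ⟨V, hV⟩ ⟨⊤, isAffineOpen_top U⟩ hUV
  obtain ⟨E, _, _, ι', _, _, F', _, eE, hinj, hic⟩ := exists_ambient_prod_fields_of_etale
    (P := Γ(Y, V)) (BV := Γ(X, f ⁻¹ᵁ V)) (K := X.functionField) (R := Γ(U, ⊤))
    (X.germToFunctionField_injective _) (mem_range_of_isIntegral_sections hN (f ⁻¹ᵁ V))
  obtain ⟨e₀, -, -⟩ := exists_ringEquiv_tensor_sections_pullback f g hV hUV
  let θ : Γ(X, f ⁻¹ᵁ V) ⊗[Γ(Y, V)] Γ(U, ⊤) ≃+* Γ(pullback f g, ⊤) :=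
    (Algebra.TensorProduct.comm Γ(Y, V) Γ(X, f ⁻¹ᵁ V) Γ(U, ⊤)).toRingEquiv.trans e₀
  letI algBE : Algebra Γ(pullback f g, ⊤) E :=
    ((algebraMap (Γ(X, f ⁻¹ᵁ V) ⊗[Γ(Y, V)] Γ(U, ⊤)) E).comp θ.symm.toRingHom).toAlgebra
  have hinj' : Function.Injective (algebraMap Γ(pullback f g, ⊤) E) :=
    hinj.comp θ.symm.injective
  have hic' : ∀ z : E, IsIntegral Γ(pullback f g, ⊤) z →
      z ∈ (algebraMap Γ(pullback f g, ⊤) E).range := by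
    intro z hz
    have hz' : IsIntegral (Γ(X, f ⁻¹ᵁ V) ⊗[Γ(Y, V)] Γ(U, ⊤)) z := by
      obtain ⟨p, hp, hpz⟩ := hz
      refine ⟨p.map θ.symm.toRingHom, hp.map _, ?_⟩
      rw [Polynomial.eval₂_map]
      exact hpz
    obtain ⟨w, hw⟩ := hic z hz'
    refine ⟨θ w, ?_⟩
    rw [← hw]
    change algebraMap _ E (θ.symm (θ w)) = _
    rw [θ.symm_apply_apply]
  haveI : Algebra.Etale Γ(U, ⊤) Γ(pullback f g, ⊤) :=
    etale_of_idempotents_met_by_sections hinj' hic' eE hsec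
  exact etale_fromNormalization_of_etale_appTop (pullback.snd f g)
    (show Algebra.Etale Γ(U, ⊤) Γ(pullback f g, ⊤) from inferInstance)

/-- **De Jong 1996, 4.12: "`Y' → ℙ^{d-1}` is (finite) étale, in view of property (ii) b)" — the
general theorem.** Let `k` be algebraically closed, `Y` locally of finite type over `k`, `X`
integral with integrally closed local rings, `f : X → Y` proper, surjective and locally of finite
presentation such that for every closed `y ∈ Y` the smooth locus of `f` is dense in `X_y`. Then
the finite part `Y' = f.normalization → Y` of the Stein factorisation of `f` is étale.
[cite: DeJong1996, 4.12, p. 68] -/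
theorem etale_fromNormalization_of_dense_smoothLocus {k : Type u} [Field k] [IsAlgClosed k]
    {X Y : Scheme.{u}} [IsIntegral X] (hN : ∀ x : X, IsIntegrallyClosed (X.presheaf.stalk x))
    (gY : Y ⟶ Spec (.of k)) [LocallyOfFiniteType gY] (f : X ⟶ Y) [IsProper f] [Surjective f]
    [LocallyOfFinitePresentation f]
    (hsm : ∀ y : Y, IsClosed ({y} : Set Y) →
      Dense ((f.fiberι y) ⁻¹' (f.smoothLocus : Set X))) :
    Etale f.fromNormalization := by
  haveI : JacobsonSpace Y := LocallyOfFiniteType.jacobsonSpace gY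
  exact etale_fromNormalization_of_forall_isClosed f fun y hy =>
    exists_etale_nhd_etale_fromNormalization hN gY f y hy (hsm y hy)

end Literature.AlgebraicGeometry.Resolution

end
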